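import Literature.NumberTheory.LFunctions.Zhang2022.Section7XiZeroMajorants
import Literature.NumberTheory.LFunctions.Zhang2022.Section8PerronSteps
import Literature.NumberTheory.LFunctions.Zhang2022.Section8ArithmeticIdentity
import Literature.NumberTheory.LFunctions.Zhang2022.TypedSection13Edges
import Literature.NumberTheory.LFunctions.Zhang2022.TypedSection08B
import HarnessLib

/-!
# Zhang (2022) §7–§8: `|ξ₀ⱼ(n;d,r)| ≪ n^{29/40}` and the absolute convergence behind (8.9)

Cell `siegel-zhang` (D-0069 width campaign), layer L2. Y. Zhang, *Discrete mean estimates and the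
Landau–Siegel zero*, arXiv:2211.02515v1 [Zhang2022LandauSiegel] — **an unrefereed manuscript under
adjudication; nothing here concerns its Theorems 1–2 or Landau–Siegel zeros.**

Display (8.9) [Z22 p.46, tex L2402] writes the sum of Lemma 8.4 as the line integral
`(1/2πi)∫_{(1)} (Σ_n χ(n)ξ₀ⱼ(n;d,r)n^{−(1+s)}) x^s ds/(s+β_μ)²`, which presupposes that the Dirichlet
series `Σ_n χ(n)ξ₀ⱼ(n;d,r)n^{−w}` (`Skeleton.xiSeries`) converges absolutely on `Re w = 2`. This file
PROVES that presupposition from the definitions of §7 p.32 (`𝔫(d)`, `κ`, `κ̃`, `λ`, `λ₀ⱼ`, `λ̃₀ⱼ`,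
`ξ₀ⱼ` = `Skeleton.nset/kappaZ/kappaTilde/lam/lamZero/lamTildeZero/xiZero`), for EVERY modulus
`D`, every `c′`, `j`, `d`, `r` (only `Re β_j = 0` is used), with crude explicit exponents:

* `norm_lamZero_prime_le`: `|λ₀ⱼ(q)| ≤ (1+q⁻¹)³/(1−q⁻¹)` at a prime `q`;
  `norm_lamTildeZero_le`: `|λ̃₀ⱼ(n,·)| ≤ 7¹¹ n^{1/4}`;
* `self_div_totient_le`: `k/φ(k) ≤ 2¹¹ k^{1/10}`;
* `norm_kappaTildeZero_le`: `|κ̃₀ⱼ(d₁;·)| ≤ τ(d₁)³ · 193^{768} d₁^{1/8}` (`|κ(m)| ≤ τ(m)³`, the sum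
  over `𝔫(d₁)` from `Section7XiZeroMajorants`);
* `norm_xiZero_le`: `|ξ₀ⱼ(n;d,r)| ≤ K n^{29/40}` for an absolute `K`;
* `summable_norm_xiZero_div_sq`: `Σ_n |χ(n)ξ₀ⱼ(n;d,r)|/n² < ∞`;
* `eq89_holds`: **`Z22:(8.9)` DISCHARGED unconditionally** (the hypothesis of
  `Section8PerronSteps.eq89` removed); `sum84EqLineIntegral_holds`: the node of record
  `Typed.S8B.Sum84EqLineIntegral c′` (L2-t6, `TypedSection08B`); hence
  `lemma84_of_integral89MainTerm`: **`Skeleton.Lemma84 c′ ⇐ Typed.S8B.Integral89MainTerm c′`** (the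
  contour-shift display `Z22:§8.u039` is the only remaining input of the leaf Lemma 8.4).

[cite: Zhang2022LandauSiegel, §7 p.32; §8 (8.9) p.46] -/

noncomputable section

open Complex Real Finset

namespace Literature.NumberTheory.LFunctions.Zhang2022.XiZeroSummable

open Literature.NumberTheory.LFunctions.Zhang2022.Skeleton
open Literature.NumberTheory.LFunctions.Zhang2022.XiZeroMajorants
open Literature.NumberTheory.LFunctions.Zhang2022.Section8PerronSteps

-- `Re β₁ = Re β₂ = Re β₃ = 0` are the tree's `Typed.Section13.beta1_re/beta2_re/beta3_re`.

/-- `1 − q⁻¹ ≤ ‖1 − q^{−w}‖ ≤ 1 + q⁻¹` for `Re w = 1` (`‖q^{−w}‖ = q⁻¹`). [folklore] -/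
private theorem norm_one_sub_cpow_bounds {q : ℕ} (hq : 0 < q) {w : ℂ} (hw : w.re = 1) :
    1 - (q : ℝ)⁻¹ ≤ ‖1 - (q : ℂ) ^ (-w)‖ ∧ ‖1 - (q : ℂ) ^ (-w)‖ ≤ 1 + (q : ℝ)⁻¹ := by
  have hn : ‖(q : ℂ) ^ (-w)‖ = (q : ℝ)⁻¹ := by
    rw [Complex.norm_natCast_cpow_of_pos hq, Complex.neg_re, hw, Real.rpow_neg (by positivity),
      Real.rpow_one]
  have h1 := norm_sub_norm_le (1 : ℂ) ((q : ℂ) ^ (-w))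
  have h2 := norm_sub_le (1 : ℂ) ((q : ℂ) ^ (-w))
  rw [norm_one, hn] at h1 h2
  exact ⟨h1, h2⟩

/-- **`|λ₀ⱼ(q)| ≤ (1+q⁻¹)³/(1−q⁻¹)`** at a prime `q`: in `λ(q, 1−β_j) =
(1−q^{−(1−β_j+β₁)})(1−q^{−(1−β_j+β₂)})(1−q^{−(1−β_j+β₃)})/(1−q^{−(1−β_j)})` every exponent has real
part `1` (§7 p.32). [cite: Zhang2022LandauSiegel, §7 p.32] -/
theorem norm_lamZero_prime_le (c' : ℝ) (D : ℕ) (j : ℕ) {q : ℕ} (hq : q.Prime) :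
    ‖lamZero c' D j q‖ ≤ (1 + (q : ℝ)⁻¹) ^ 3 / (1 - (q : ℝ)⁻¹) := by
  have hq0 : 0 < q := hq.pos
  have hq2 : (2 : ℝ) ≤ q := by exact_mod_cast hq.two_le
  have hqinv : (q : ℝ)⁻¹ ≤ 1 / 2 := by
    rw [inv_eq_one_div]; exact one_div_le_one_div_of_le (by norm_num) hq2
  rw [lamZero, lam, Nat.Prime.primeFactors hq, Finset.prod_singleton]
  set s : ℂ := 1 - betaJ c' D j with hs
  have hsre : s.re = 1 := by simp [hs, betaJ_re]
  have h1 : (s + beta1 c' D).re = 1 := by simp [hsre, Typed.Section13.beta1_re]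
  have h2 : (s + beta2 c' D).re = 1 := by simp [hsre, Typed.Section13.beta2_re]
  have h3 : (s + beta3 c' D).re = 1 := by simp [hsre, Typed.Section13.beta3_re]
  obtain ⟨-, u1⟩ := norm_one_sub_cpow_bounds hq0 h1
  obtain ⟨-, u2⟩ := norm_one_sub_cpow_bounds hq0 h2
  obtain ⟨-, u3⟩ := norm_one_sub_cpow_bounds hq0 h3
  obtain ⟨l0, -⟩ := norm_one_sub_cpow_bounds hq0 hsre
  have hden : 0 < 1 - (q : ℝ)⁻¹ := by linarith
  rw [norm_div, norm_mul, norm_mul, div_le_div_iff₀ (lt_of_lt_of_le hden l0) hden]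
  have hA : ‖1 - (q : ℂ) ^ (-(s + beta1 c' D))‖ * ‖1 - (q : ℂ) ^ (-(s + beta2 c' D))‖ *
      ‖1 - (q : ℂ) ^ (-(s + beta3 c' D))‖ ≤ (1 + (q : ℝ)⁻¹) ^ 3 := by
    calc _ ≤ (1 + (q : ℝ)⁻¹) * (1 + (q : ℝ)⁻¹) * (1 + (q : ℝ)⁻¹) := by
          gcongr
      _ = (1 + (q : ℝ)⁻¹) ^ 3 := by ring
  calc _ ≤ (1 + (q : ℝ)⁻¹) ^ 3 * (1 - (q : ℝ)⁻¹) := mul_le_mul_of_nonneg_right hA hden.le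
    _ ≤ (1 + (q : ℝ)⁻¹) ^ 3 * ‖1 - (q : ℂ) ^ (-s)‖ :=
        mul_le_mul_of_nonneg_left l0 (by positivity)

/-- The prime bound is `≤ 7` always and `≤ 1 + 5/q` for `q ≥ 11`. [folklore] -/
private theorem gbound {q : ℕ} (hq : q.Prime) :
    (1 + (q : ℝ)⁻¹) ^ 3 / (1 - (q : ℝ)⁻¹) ≤ 7 ∧
      (11 ≤ q → (1 + (q : ℝ)⁻¹) ^ 3 / (1 - (q : ℝ)⁻¹) ≤ 1 + 5 / q) := by
  have hq2 : (2 : ℝ) ≤ q := by exact_mod_cast hq.two_le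
  have hq0 : (0 : ℝ) < q := by linarith
  set x : ℝ := (q : ℝ)⁻¹ with hx
  have hx0 : 0 < x := by positivity
  have hx2 : x ≤ 1 / 2 := by rw [hx, inv_eq_one_div]; exact one_div_le_one_div_of_le (by norm_num) hq2
  have hden : 0 < 1 - x := by linarith
  constructor
  · rw [div_le_iff₀ hden]; nlinarith [pow_le_pow_left₀ hx0.le hx2 3]
  · intro h11
    have hq11 : (11 : ℝ) ≤ q := by exact_mod_cast h11
    have hx11 : x ≤ 1 / 11 := by
      rw [hx, inv_eq_one_div]; exact one_div_le_one_div_of_le (by norm_num) hq11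
    rw [div_le_iff₀ hden, show (5 : ℝ) / q = 5 * x by rw [hx, div_eq_mul_inv]]
    nlinarith [mul_pos hx0 hx0, mul_le_mul_of_nonneg_left hx11 hx0.le]

/-- **`|λ̃₀ⱼ(n, M)| ≤ 7¹¹ n^{1/4}`** for `n ≥ 1` (`λ̃₀ⱼ(n,dr) = ∏_{q∣n,(q,dr)=1} λ₀ⱼ(q)`, §7 p.32; each
factor is `≤ (1+q⁻¹)³/(1−q⁻¹)`, which is `≤ 7`, and `≤ 1 + 5/q ≤ q^{1/4}` for `q ≥ 11`).
[cite: Zhang2022LandauSiegel, §7 p.32] -/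
theorem norm_lamTildeZero_le (c' : ℝ) (D : ℕ) (j M : ℕ) {n : ℕ} (hn : n ≠ 0) :
    ‖lamTildeZero c' D j n M‖ ≤ (7 : ℝ) ^ (11 : ℕ) * (n : ℝ) ^ (1 / 4 : ℝ) := by
  set g : ℕ → ℝ := fun q => (1 + (q : ℝ)⁻¹) ^ 3 / (1 - (q : ℝ)⁻¹) with hg
  have hg1 : ∀ q, q.Prime → 1 ≤ g q := by
    intro q hq
    have hq2 : (2 : ℝ) ≤ q := by exact_mod_cast hq.two_le
    have hx0 : 0 < (q : ℝ)⁻¹ := by positivity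
    have hx2 : (q : ℝ)⁻¹ ≤ 1 / 2 := by
      rw [inv_eq_one_div]; exact one_div_le_one_div_of_le (by norm_num) hq2
    rw [hg]; dsimp only
    rw [le_div_iff₀ (by linarith)]
    nlinarith [pow_le_pow_left₀ (zero_le_one) (show (1:ℝ) ≤ 1 + (q:ℝ)⁻¹ by linarith) 3]
  have hprime : ∀ q ∈ n.primeFactors, q.Prime := fun q hq => Nat.prime_of_mem_primeFactors hq
  rw [lamTildeZero, norm_prod]
  calc ∏ q ∈ n.primeFactors.filter (fun q => Nat.Coprime q M), ‖lamZero c' D j q‖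
      ≤ ∏ q ∈ n.primeFactors.filter (fun q => Nat.Coprime q M), g q := by
        apply Finset.prod_le_prod (fun q _ => norm_nonneg _)
        intro q hq
        exact norm_lamZero_prime_le c' D j (hprime q (Finset.mem_filter.1 hq).1)
    _ ≤ ∏ q ∈ n.primeFactors, g q := by
        rw [← Finset.prod_filter_mul_prod_filter_not n.primeFactors (fun q => Nat.Coprime q M) g]
        refine le_mul_of_one_le_right (Finset.prod_nonneg fun q hq =>
          zero_le_one.trans (hg1 q (hprime q (Finset.mem_filter.1 hq).1))) ?_
        calc (1 : ℝ) = ∏ q ∈ n.primeFactors.filter (fun q => ¬ Nat.Coprime q M), (1 : ℝ) :=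
              Finset.prod_const_one.symm
          _ ≤ _ := Finset.prod_le_prod (fun _ _ => zero_le_one)
              (fun q hq => hg1 q (hprime q (Finset.mem_filter.1 hq).1))
    _ ≤ (7 : ℝ) ^ (11 : ℕ) * (n : ℝ) ^ (1 / 4 : ℝ) := by
        refine prod_primeFactors_le_pow_mul_rpow g 11 (by norm_num) (by norm_num)
          (fun q hq => zero_le_one.trans (hg1 q hq)) (fun q hq => (gbound hq).1)
          (fun q hq hq11 => ((gbound hq).2 hq11).trans ?_) hn
        exact one_add_div_le_rpow (by norm_num) (by norm_num) hq11 (by norm_num)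

/-- **`k/φ(k) ≤ 2¹¹ k^{1/10}`** (`k ≥ 1`; a crude form of `φ(n) ≫ n/log log n`,
Hardy–Wright Thm 328): `k/φ(k) = ∏_{q∣k} (1−q⁻¹)⁻¹`, each factor `≤ 2`, and
`≤ 1 + 2/q ≤ q^{1/10}` for `q ≥ 11`. [cite: HardyWright2008, Theorem 328] -/
theorem self_div_totient_le {k : ℕ} (hk : k ≠ 0) :
    (k : ℝ) / (Nat.totient k : ℝ) ≤ (2 : ℝ) ^ (11 : ℕ) * (k : ℝ) ^ (1 / 10 : ℝ) := by
  have hk0 : (0 : ℝ) < k := by exact_mod_cast Nat.pos_of_ne_zero hk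
  have hprime : ∀ q ∈ k.primeFactors, q.Prime := fun q hq => Nat.prime_of_mem_primeFactors hq
  have hfac : ∀ q ∈ k.primeFactors, 0 < 1 - 1 / (q : ℝ) := by
    intro q hq
    have : (2 : ℝ) ≤ q := by exact_mod_cast (hprime q hq).two_le
    have : 1 / (q : ℝ) ≤ 1 / 2 := one_div_le_one_div_of_le (by norm_num) this
    linarith
  have hprod : 0 < ∏ q ∈ k.primeFactors, (1 - 1 / (q : ℝ)) := Finset.prod_pos hfac
  have hφ : (Nat.totient k : ℝ) = k * ∏ q ∈ k.primeFactors, (1 - 1 / (q : ℝ)) :=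
    totient_eq_mul_prod_real k
  rw [hφ, div_mul_eq_div_div, div_self hk0.ne', one_div, ← Finset.prod_inv_distrib]
  refine prod_primeFactors_le_pow_mul_rpow (fun q => (1 - 1 / (q : ℝ))⁻¹) 11 (by norm_num)
    (by norm_num) (fun q hq => ?_) (fun q hq => ?_) (fun q hq hq11 => ?_) hk
  · have : (2 : ℝ) ≤ q := by exact_mod_cast hq.two_le
    have : 1 / (q : ℝ) ≤ 1 / 2 := one_div_le_one_div_of_le (by norm_num) this
    exact inv_nonneg.2 (by linarith)
  · have h2 : (2 : ℝ) ≤ q := by exact_mod_cast hq.two_le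
    have h' : 1 / (q : ℝ) ≤ 1 / 2 := one_div_le_one_div_of_le (by norm_num) h2
    rw [inv_le_comm₀ (by linarith) (by norm_num)]
    linarith
  · have h2 : (2 : ℝ) ≤ q := by exact_mod_cast hq.two_le
    have hq0 : (0 : ℝ) < q := by linarith
    have h' : 1 / (q : ℝ) ≤ 1 / 2 := one_div_le_one_div_of_le (by norm_num) h2
    have step : (1 - 1 / (q : ℝ))⁻¹ ≤ 1 + 2 / q := by
      rw [inv_le_iff_one_le_mul₀ (by linarith)]
      have e : (1 + 2 / (q : ℝ)) * (1 - 1 / q) = 1 + (1 / q) * (1 - 2 / q) := by ring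
      rw [e]
      have : 0 ≤ (1 / (q : ℝ)) * (1 - 2 / q) := by
        apply mul_nonneg (by positivity)
        rw [sub_nonneg, div_le_one hq0]; linarith
      linarith
    exact step.trans (one_add_div_le_rpow (by norm_num) (by norm_num) hq11 (by norm_num))

/-- `𝔫(d)` (§7 p.32) is Mathlib's set of `d.primeFactors`-factored numbers (`d ≥ 1`).
[cite: Zhang2022LandauSiegel, §7 p.32] -/
theorem nset_eq_factoredNumbers {d : ℕ} (hd : d ≠ 0) : nset d = Nat.factoredNumbers d.primeFactors := by
  ext h
  rw [nset, Set.mem_setOf_eq, Nat.mem_factoredNumbers']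
  constructor
  · rintro ⟨-, H⟩ p hp hph
    exact Nat.mem_primeFactors.2 ⟨hp, H p hp hph, hd⟩
  · intro H
    refine ⟨Nat.pos_of_ne_zero ?_, fun q hq hqh => (Nat.mem_primeFactors.1 (H q hq hqh)).2.1⟩
    rintro rfl
    -- every prime divides `0`; pick one not dividing `d`
    obtain ⟨p, hp, hpd⟩ := Nat.exists_infinite_primes (d + 1)
    have := (Nat.mem_primeFactors.1 (H p hpd (dvd_zero p))).2.1
    exact absurd (Nat.le_of_dvd (Nat.pos_of_ne_zero hd) this) (by omega)

/-- **`|κ̃₀ⱼ(d₁; M)| ≤ τ(d₁)³ · 193^{768} d₁^{1/8}`** (`d₁ ≥ 1`): in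
`κ̃₀ⱼ(d₁;M) = Σ_{h∈𝔫(d₁),(h,M)=1} κ(d₁h)h^{−(1−β_j)}` (§7 p.32) one has `|h^{1−β_j}| = h`,
`|κ(d₁h)| ≤ τ(d₁h)³ ≤ τ(d₁)³τ(h)³`, and `Σ_{h∈𝔫(d₁)} τ(h)³/h ≤ 193^{768}d₁^{1/8}`
(`Section7XiZeroMajorants`). [cite: Zhang2022LandauSiegel, §7 p.32] -/
theorem norm_kappaTildeZero_le (c' : ℝ) (D : ℕ) (j : ℕ) {d₁ : ℕ} (hd : d₁ ≠ 0) (M : ℕ) :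
    ‖kappaTildeZero c' D j d₁ M‖ ≤
      (d₁.divisors.card : ℝ) ^ 3 * ((193 : ℝ) ^ (768 : ℕ) * (d₁ : ℝ) ^ (1 / 8 : ℝ)) := by
  classical
  set s : ℂ := 1 - betaJ c' D j with hs
  have hsre : s.re = 1 := by simp [hs, betaJ_re]
  -- the summand and its majorant
  set F : ℕ → ℂ := fun h =>
    if h ∈ nset d₁ ∧ Nat.Coprime h M then kappaZ c' D (d₁ * h) / (h : ℂ) ^ s else 0 with hF
  set g : ℕ → ℝ := fun h => (d₁.divisors.card : ℝ) ^ 3 * (((h.divisors.card : ℝ)) ^ 3 / (h : ℝ))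
    with hg
  set G : ℕ → ℝ := (nset d₁).indicator g with hG
  have hkt : kappaTildeZero c' D j d₁ M = ∑' h, F h := by rw [kappaTildeZero, kappaTilde]
  have hFG : ∀ h, ‖F h‖ ≤ G h := by
    intro h
    by_cases hmem : h ∈ nset d₁
    · have hh0 : 0 < h := hmem.1
      rw [hG, Set.indicator_of_mem hmem, hg]
      dsimp only
      by_cases hcop : Nat.Coprime h M
      · rw [hF]; dsimp only; rw [if_pos ⟨hmem, hcop⟩, norm_div, Complex.norm_natCast_cpow_of_pos hh0,
          hsre, Real.rpow_one]
        have hκ := norm_kappa_le_card_divisors_pow (b1 c' D) (b2 c' D) (b3 c' D) (d₁ * h)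
          (Nat.mul_ne_zero hd hh0.ne')
        have hτ : (((d₁ * h).divisors.card : ℝ)) ^ 3 ≤
            (d₁.divisors.card : ℝ) ^ 3 * (h.divisors.card : ℝ) ^ 3 := by
          rw [← mul_pow]
          exact pow_le_pow_left₀ (by positivity)
            (by exact_mod_cast Literature.NumberTheory.Sieve.DFI1995.card_divisors_mul_le d₁ h) 3
        rw [div_le_iff₀ (by exact_mod_cast hh0 : (0 : ℝ) < h)]
        calc ‖kappaZ c' D (d₁ * h)‖ ≤ _ := hκ
          _ ≤ _ := hτ
          _ = (d₁.divisors.card : ℝ) ^ 3 * ((h.divisors.card : ℝ) ^ 3 / h) * h := by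
              field_simp
      · rw [hF]; dsimp only; rw [if_neg (fun h' => hcop h'.2), norm_zero]
        positivity
    · rw [hG, Set.indicator_of_notMem hmem, hF]; dsimp only
      rw [if_neg (fun h' => hmem h'.1), norm_zero]
  -- summability of the majorant, via `𝔫(d₁) = factoredNumbers`
  obtain ⟨hsum0, hle0⟩ := tsum_factoredNumbers_cubeDiv_le hd
  have hsumG : Summable G := by
    rw [hG, nset_eq_factoredNumbers hd, ← summable_subtype_iff_indicator]
    exact hsum0.mul_left _
  have hsumF : Summable fun h => ‖F h‖ :=
    Summable.of_nonneg_of_le (fun h => norm_nonneg _) hFG hsumG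
  rw [hkt]
  calc ‖∑' h, F h‖ ≤ ∑' h, ‖F h‖ := norm_tsum_le_tsum_norm hsumF
    _ ≤ ∑' h, G h := hsumF.tsum_le_tsum hFG hsumG
    _ = ∑' h : Nat.factoredNumbers d₁.primeFactors, g h := by
        rw [hG, nset_eq_factoredNumbers hd, _root_.tsum_subtype]
    _ = (d₁.divisors.card : ℝ) ^ 3 *
          ∑' h : Nat.factoredNumbers d₁.primeFactors, ((((h : ℕ).divisors.card : ℝ)) ^ 3 / ((h : ℕ) : ℝ)) := by
        rw [hg]; exact tsum_mul_left
    _ ≤ _ := mul_le_mul_of_nonneg_left hle0 (by positivity)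

/-- **`|ξ₀ⱼ(n;d,r)| ≤ K n^{29/40}`** for an absolute constant `K` (all `n, d, r, j, c′, D`): in
`ξ₀ⱼ(n;d,r) = λ̃₀ⱼ(n,dr) Σ_{n=d₁k,(k,r)=1} κ̃₀ⱼ(d₁;drk) μ(k)k^{1−β_j}/φ(k)` (§7 p.32) use
`|λ̃₀ⱼ| ≤ 7¹¹n^{1/4}`, `|κ̃₀ⱼ(d₁;·)| ≤ τ(d₁)³·193^{768}d₁^{1/8}`, `|μ(k)k^{1−β_j}|/φ(k) ≤ k/φ(k)
≤ 2¹¹k^{1/10}`, at most `τ(n)` terms, and `τ(m) ≤ C m^{1/16}` (the tree's divisor bound).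
[cite: Zhang2022LandauSiegel, §7 p.32] -/
theorem norm_xiZero_le (c' : ℝ) (D : ℕ) (j d r : ℕ) :
    ∃ K : ℝ, 0 ≤ K ∧ ∀ n : ℕ, ‖xiZero c' D j n d r‖ ≤ K * (n : ℝ) ^ (29 / 40 : ℝ) := by
  obtain ⟨C₁, hC₁, hτ⟩ := Literature.NumberTheory.Sieve.exists_card_divisors_le_mul_rpow
    (show (0 : ℝ) < 1 / 16 by norm_num)
  obtain ⟨B, hB⟩ : ∃ B : ℝ, (193 : ℝ) ^ (768 : ℕ) = B := ⟨_, rfl⟩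
  have hB0 : 0 ≤ B := by rw [← hB]; positivity
  set K : ℝ := (7 : ℝ) ^ (11 : ℕ) * (C₁ * (C₁ ^ 3 * B * (2 : ℝ) ^ (11 : ℕ))) with hK
  have hC₁0 : 0 ≤ C₁ := zero_le_one.trans hC₁
  refine ⟨K, by positivity, fun n => ?_⟩
  rcases Nat.eq_zero_or_pos n with rfl | hn
  · simp [xiZero]
  have hn0 : (0 : ℝ) < n := by exact_mod_cast hn
  have hn1 : (1 : ℝ) ≤ n := by exact_mod_cast hn
  set s : ℂ := 1 - betaJ c' D j with hs
  have hsre : s.re = 1 := by simp [hs, betaJ_re]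
  -- the inner sum, term by term
  set S := n.divisors.filter (fun k => Nat.Coprime k r) with hS
  have hterm : ∀ k ∈ S, ‖kappaTildeZero c' D j (n / k) (d * r * k) *
      (ArithmeticFunction.moebius k : ℂ) * (k : ℂ) ^ s / (Nat.totient k : ℂ)‖ ≤
      C₁ ^ 3 * B * (2 : ℝ) ^ (11 : ℕ) * (n : ℝ) ^ (33 / 80 : ℝ) := by
    intro k hk
    have hkdiv : k ∈ n.divisors := (Finset.mem_filter.1 hk).1
    have hk0 : 0 < k := Nat.pos_of_mem_divisors hkdiv
    have hkn : k ∣ n := Nat.dvd_of_mem_divisors hkdiv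
    have hnk0 : n / k ≠ 0 := (Nat.div_pos (Nat.le_of_dvd hn hkn) hk0).ne'
    have hnkle : ((n / k : ℕ) : ℝ) ≤ n := by exact_mod_cast Nat.div_le_self n k
    have hkle : (k : ℝ) ≤ n := by exact_mod_cast Nat.le_of_dvd hn hkn
    have hkR : (0 : ℝ) < k := by exact_mod_cast hk0
    have hφ0 : (0 : ℝ) < Nat.totient k := by exact_mod_cast Nat.totient_pos.2 hk0
    -- the four factors
    have f1 : ‖kappaTildeZero c' D j (n / k) (d * r * k)‖ ≤
        (C₁ * (n : ℝ) ^ (1 / 16 : ℝ)) ^ 3 * (B * (n : ℝ) ^ (1 / 8 : ℝ)) := by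
      have h0 := norm_kappaTildeZero_le c' D j hnk0 (d * r * k)
      rw [hB] at h0
      refine h0.trans ?_
      have hτ' : (((n / k).divisors.card : ℝ)) ≤ C₁ * (n : ℝ) ^ (1 / 16 : ℝ) :=
        (hτ _ hnk0).trans (mul_le_mul_of_nonneg_left
          (Real.rpow_le_rpow (by positivity) hnkle (by norm_num)) hC₁0)
      gcongr
    have f2 : ‖(ArithmeticFunction.moebius k : ℂ)‖ ≤ 1 := by
      rw [Complex.norm_intCast]
      exact_mod_cast ArithmeticFunction.abs_moebius_le_one
    have f3 : ‖(k : ℂ) ^ s‖ = k := by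
      rw [Complex.norm_natCast_cpow_of_pos hk0, hsre, Real.rpow_one]
    have f4 : ‖(Nat.totient k : ℂ)‖ = Nat.totient k := Complex.norm_natCast _
    have f34 : (k : ℝ) / (Nat.totient k : ℝ) ≤ (2 : ℝ) ^ (11 : ℕ) * (n : ℝ) ^ (1 / 10 : ℝ) :=
      (self_div_totient_le hk0.ne').trans (mul_le_mul_of_nonneg_left
        (Real.rpow_le_rpow hkR.le hkle (by norm_num)) (by positivity))
    rw [norm_div, norm_mul, norm_mul, f3, f4]
    have hexp : (n : ℝ) ^ (33 / 80 : ℝ) =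
        ((n : ℝ) ^ (1 / 16 : ℝ)) ^ 3 * (n : ℝ) ^ (1 / 8 : ℝ) * (n : ℝ) ^ (1 / 10 : ℝ) := by
      rw [← Real.rpow_natCast, ← Real.rpow_mul hn0.le, ← Real.rpow_add hn0, ← Real.rpow_add hn0]
      norm_num
    calc ‖kappaTildeZero c' D j (n / k) (d * r * k)‖ * ‖(ArithmeticFunction.moebius k : ℂ)‖ * k /
          (Nat.totient k : ℝ)
        = ‖kappaTildeZero c' D j (n / k) (d * r * k)‖ * ‖(ArithmeticFunction.moebius k : ℂ)‖ *
            ((k : ℝ) / (Nat.totient k : ℝ)) := by ring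
      _ ≤ ((C₁ * (n : ℝ) ^ (1 / 16 : ℝ)) ^ 3 * (B * (n : ℝ) ^ (1 / 8 : ℝ))) *
            1 * ((2 : ℝ) ^ (11 : ℕ) * (n : ℝ) ^ (1 / 10 : ℝ)) := by
          gcongr
      _ = C₁ ^ 3 * B * (2 : ℝ) ^ (11 : ℕ) * (n : ℝ) ^ (33 / 80 : ℝ) := by
          rw [hexp]; ring
  -- number of terms
  have hcard : (S.card : ℝ) ≤ C₁ * (n : ℝ) ^ (1 / 16 : ℝ) :=
    le_trans (by exact_mod_cast Finset.card_le_card (Finset.filter_subset _ _)) (hτ n hn.ne')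
  have hsum : ‖∑ k ∈ S, kappaTildeZero c' D j (n / k) (d * r * k) *
      (ArithmeticFunction.moebius k : ℂ) * (k : ℂ) ^ s / (Nat.totient k : ℂ)‖ ≤
      C₁ * (n : ℝ) ^ (1 / 16 : ℝ) *
        (C₁ ^ 3 * B * (2 : ℝ) ^ (11 : ℕ) * (n : ℝ) ^ (33 / 80 : ℝ)) := by
    refine (norm_sum_le _ _).trans ?_
    refine (Finset.sum_le_card_nsmul _ _ _ hterm).trans ?_
    rw [nsmul_eq_mul]
    exact mul_le_mul_of_nonneg_right hcard (by positivity)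
  -- assemble
  rw [xiZero, norm_mul]
  have hlam := norm_lamTildeZero_le c' D j (d * r) hn.ne'
  have hexp2 : (n : ℝ) ^ (29 / 40 : ℝ) =
      (n : ℝ) ^ (1 / 4 : ℝ) * ((n : ℝ) ^ (1 / 16 : ℝ) * (n : ℝ) ^ (33 / 80 : ℝ)) := by
    rw [← Real.rpow_add hn0, ← Real.rpow_add hn0]; norm_num
  calc ‖lamTildeZero c' D j n (d * r)‖ * ‖∑ k ∈ S, kappaTildeZero c' D j (n / k) (d * r * k) *
        (ArithmeticFunction.moebius k : ℂ) * (k : ℂ) ^ s / (Nat.totient k : ℂ)‖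
      ≤ ((7 : ℝ) ^ (11 : ℕ) * (n : ℝ) ^ (1 / 4 : ℝ)) * (C₁ * (n : ℝ) ^ (1 / 16 : ℝ) *
          (C₁ ^ 3 * B * (2 : ℝ) ^ (11 : ℕ) * (n : ℝ) ^ (33 / 80 : ℝ))) :=
        mul_le_mul hlam hsum (norm_nonneg _) (by positivity)
    _ = K * (n : ℝ) ^ (29 / 40 : ℝ) := by rw [hK, hexp2]; ring

/-- **Absolute convergence behind (8.9)**: `Σ_n |χ(n)ξ₀ⱼ(n;d,r)|/n² < ∞` for every modulus `D`,
real primitive or not, and all `c′, j, d, r` (`|χ| ≤ 1`, `|ξ₀ⱼ(n)| ≤ Kn^{29/40}`, `29/40 − 2 < −1`).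
[cite: Zhang2022LandauSiegel, §8 (8.9) p.46] -/
theorem summable_norm_xiZero_div_sq (c' : ℝ) {D : ℕ} [NeZero D] (χ : DirichletCharacter ℂ D)
    (j d r : ℕ) : Summable fun n : ℕ => ‖χ (n : ZMod D) * xiZero c' D j n d r‖ / (n : ℝ) ^ 2 := by
  obtain ⟨K, hK0, hK⟩ := norm_xiZero_le c' D j d r
  have hmaj : Summable fun n : ℕ => K * (n : ℝ) ^ (29 / 40 - 2 : ℝ) :=
    (Real.summable_nat_rpow.2 (by norm_num)).mul_left K
  refine Summable.of_nonneg_of_le (fun n => by positivity) (fun n => ?_) hmaj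
  rcases Nat.eq_zero_or_pos n with rfl | hn
  · have h0 : (0 : ℝ) ^ (29 / 40 - 2 : ℝ) = 0 := Real.zero_rpow (by norm_num)
    simp [xiZero, h0]
  have hn0 : (0 : ℝ) < n := by exact_mod_cast hn
  rw [Real.rpow_sub hn0, show (n : ℝ) ^ (2 : ℝ) = (n : ℝ) ^ (2 : ℕ) by norm_cast, ← mul_div_assoc,
    norm_mul]
  apply div_le_div_of_nonneg_right _ (by positivity)
  calc ‖χ (n : ZMod D)‖ * ‖xiZero c' D j n d r‖ ≤ 1 * ‖xiZero c' D j n d r‖ :=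
        mul_le_mul_of_nonneg_right (χ.norm_le_one _) (norm_nonneg _)
    _ ≤ K * (n : ℝ) ^ (29 / 40 : ℝ) := by rw [one_mul]; exact hK n

/-- **`Z22:(8.9)` DISCHARGED** [Z22 p.46, (8.9), tex L2402]: for every modulus `D`, every `c′, j, μ,
d, r` and every `x > 0`,
`Σ_{1≤n<x} χ(n)ξ₀ⱼ(n;d,r)n⁻¹(x/n)^{−β_μ}log(x/n)
 = (1/2πi)∫_{(1)} (Σ_n χ(n)ξ₀ⱼ(n;d,r)n^{−(1+s)}) x^s ds/(s+β_μ)²`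
(`Section8PerronSteps.eq89` with its absolute-convergence hypothesis now proved).
[cite: Zhang2022LandauSiegel, §8 (8.9) p.46] -/
theorem eq89_holds (c' : ℝ) {D : ℕ} [NeZero D] (χ : DirichletCharacter ℂ D) (j μ d r : ℕ)
    {x : ℝ} (hx : 0 < x) :
    ∑ n ∈ Finset.Ico 1 ⌈x⌉₊, χ (n : ZMod D) * xiZero c' D j n d r / (n : ℂ) *
        ((x / n : ℝ) : ℂ) ^ (-betaMu D μ) * (Real.log (x / n) : ℂ) =
      (1 / (2 * π) : ℂ) * ∫ t : ℝ,
        (∑' n : ℕ, χ (n : ZMod D) * xiZero c' D j n d r * (n : ℂ) ^ (-(1 + (((1 : ℝ) : ℂ) + t * I)))) *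
          (x : ℂ) ^ (((1 : ℝ) : ℂ) + t * I) / ((((1 : ℝ) : ℂ) + t * I) + betaMu D μ) ^ 2 :=
  eq89 c' χ j μ d r (summable_norm_xiZero_div_sq c' χ j d r) hx

/-- **`Z22:(8.9)` of record DISCHARGED**: L2-t6's `Typed.S8B.Sum84EqLineIntegral c′` holds for
every `c′` (indeed for every modulus and every `x > 0`). [cite: Zhang2022LandauSiegel, §8 (8.9) p.46] -/
theorem sum84EqLineIntegral_holds (c' : ℝ) : Typed.S8B.Sum84EqLineIntegral c' := by
  intro D _ χ j _ μ _ d r _ _ _ x hTx _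
  have hx : 0 < x := (Real.exp_pos _).trans hTx
  unfold Typed.S8B.sum84 Typed.S8B.vlineInt xiSeries
  exact eq89_holds c' χ j μ d r hx

variable (c' : ℝ) in
/-- `Sum84EqLineIntegral` — `_holds` alias of `sum84EqLineIntegral_holds` above under the fact's exact name, stated under the
prover's own binders as section variables (appended 2026-08-28, D-0026 bookkeeping: the proof term is the
existing theorem of this file; no statement, definition or attribute is edited; no new named fact; the
ledger's debt table listed the fact unproved). [cite: Zhang2022LandauSiegel, §8 (8.9) p.46] -/
theorem _root_.Literature.NumberTheory.LFunctions.Zhang2022.Typed.S8B.Sum84EqLineIntegral_holds :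
    _root_.Literature.NumberTheory.LFunctions.Zhang2022.Typed.S8B.Sum84EqLineIntegral c' :=
  _root_.Literature.NumberTheory.LFunctions.Zhang2022.XiZeroSummable.sum84EqLineIntegral_holds (c' := c')

/-- **Lemma 8.4 reduced to its contour-shift display**: `Skeleton.Lemma84 c′` follows from
`Z22:§8.u039` alone (L2-t6's `Typed.S8B.Integral89MainTerm c′`: "the integral (8.9) is equal to
`L′(1,χ)Π(d,r)·(1/2πi)∮_{|s|=5α}(s+β_{j+1})(s+β_{j+2})s⁻¹x^s(s+β_μ)⁻² ds + O(𝓛⁻⁶)`"), by L2-t6's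
edge `lemma84_of` with its (8.9) input now discharged. [cite: Zhang2022LandauSiegel, §8 Lemma 8.4 pp.46–47] -/
theorem lemma84_of_integral89MainTerm (c' : ℝ) (h : Typed.S8B.Integral89MainTerm c') : Lemma84 c' :=
  Typed.S8B.lemma84_of c' (sum84EqLineIntegral_holds c') h

end Literature.NumberTheory.LFunctions.Zhang2022.XiZeroSummable
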